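/-
Copyright: the b2b-balaban T⁴-continuum CRUX team, row NE7b, leaf lineage `t4-ne7b-formalise-leaf-02` (gen 132). Project licence.
-/
import Mathlib.Data.ZMod.Basic
import Mathlib.Data.Real.Basic
import Mathlib.Tactic.Abel
import Mathlib.Tactic.Ring

/-!
# THE INTERIOR-ROW MULTIPLICITY OF A BASED SQUARE AS A KERNEL COUNT: on the fine periodic lattice `(ℤ∕N)^d` the `n × n` square based at `x` in the
# plane `{μ, ν}` carries `2n²` interior-grid bonds — the ROWS `(x + ie_μ + je_ν, μ)` and the COLUMNS `(x + ie_μ + je_ν, ν)`, `i, j < n` — and every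
# fine bond lies in the interior grid of at most `(d−1)·n²` based squares; the THIRD count that Lemma CS at one step needs once step (i) is taken from
# leaf-05's rectangle END, whose curvature defect is weighted by the sizes of the 1-form on the INTERIOR rows of the square (row NE7b, node U5c;
# the (h1) slot of print's `γ₀` assembly, `SectE-interface-proof.md` §5.2; sequel of this lineage's `…BlockSurfaceMultiplicity` (the `n²` plaquettes and
# `4n` boundary bonds) and of `…OneStepCovariantStokes` ∕ `…OneStepCovariantStokesValue` (Lemma CS (ii) at `k = 1`))

Cell `pub-balaban`, sub-cell `t4`, spine estimate NE7b (`T4WeightBudget.RelWeightBound`; the cell's OWN estimate — NOT PRINTED in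
[Bałaban 1983–89], NOT PROVED).  Crux-route work under `Spine/NE7b/` by the row's E-side ∕ key-readings ∕ lattice-geometry leaf lineage; NOTHING
of Bałaban's is named or asserted; no `T4Continuum/Support` leaf typed; no `def`, no notation; zero `sorry`.  Imports: Mathlib ONLY.

WHY (located).  At `k = 1` the (5.2) main-part letter is assembled from `…OneStepCovariantStokesValue.norm_coarseCurl_Q0cov_bavg_le` (Lemma CS (ii),
`‖X(P)‖ ≤ Σ_r L^{−(d+1)}(‖Z_r‖ + 2δ·Σ_{three sides}‖A_b‖)`) and step (i) for `‖Z_r‖` — leaf-05's `LinearisedLatticeStokesRectangle.sz_rectWord_defect_le` ∕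
`norm_rectWord_sub_sum_le` (through `RotatedSumPairHolonomy` §5 at `G = U(n)`): `‖Z_r − Σ_{ij} φ(T_{ij})p_{ij}.left‖ ≤ c·Σ_{j<n} S_j·B_j` with
`B_j = sz (hol W x [x, x+je_μ]).left + Σ_{i<n} (sz A(x + je_μ + ie_κ, κ) + sz p_{ij}.left)` — the defect is weighted by the 1-form on the INTERIOR rows
`(x + je_μ + ie_κ, κ)`, `i, j < n`, of the square (and on its fourth side), not only on `∂S_x(P)`.  So the counting of `…CovariantStokesCounting` needs,
besides the plaquette multiplicity `n²` and the boundary multiplicity `2(d−1)n` of `…BlockSurfaceMultiplicity`, a THIRD multiplicity: how many based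
squares `(x, a)` contain a given fine bond in their interior grid.  THIS FILE is that count: `(d−1)·n²`.

WHAT IS PROVED ([folklore] lattice combinatorics; sites `x : Fin d → ZMod N`, bonds `(x, μ)`, planes `a = (μ < ν)`; the interior grid `Gr x a` — the
`2n²` bonds `(x + ie_{a.1} + je_{a.2}, a.1)` (rows) and `(x + ie_{a.1} + je_{a.2}, a.2)` (columns), `i, j < n` — is carried by a characterising
hypothesis `hGr` (image of `Bool × Fin n × Fin n`), inhabited by `exists_grid`):
* §1 `card_grid_le` (`#Gr x a ≤ 2n²`), `card_grid_mul_inv_sq_le_two` (`#Gr·n⁻² ≤ 2` for `0 < n` — a `v`-type normalisation letter).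
* §2 **`grid_multiplicity_le`**: every fine bond `(z, μ)` lies in the interior grid of at most `(d−1)·n²` based squares (cover by
  `{ν // ν ≠ μ} × Fin n × Fin n`: plane partner and the two offsets; `x = z − ie_μ − je_ν`), `grid_multiplicity_le_four` (`d = 4`: `≤ 3n²`).

NOT HERE (honest): the three-term counting lemma itself (a `…CovariantStokesCounting`-style statement with a third family `T′(P,x)` — leaf-05's or
a successor's, see INBOX L.61998), the two-scale torus re-indexing (`…BlockSurfaceMultiplicity.blockPoint_injective` transfers these bounds verbatim),
the `ℤ^d` twin for [B7]'s objects, the weights `η^d`, Lemma CS (i)–(ii) themselves, anything of Bałaban's ((A3) ∕ (A1c), NC-NE7b-α UNRULED).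
BY-NAME EFFECT ON THE WALL: NONE.  NE7b NOT PRINTED ∕ NOT PROVED; spine PROVED 0∕9; rung (B)+1 on a FINITE torus — NOT infinite volume, NOT the
mass gap, NOT Clay.
HONEST DEPENDENCY: continuum YM on T⁴ ⇐ BetaPertH ∧ nine spine estimates (0/9 proved); BetaPertH ⇐ (D1) ∧ (D4) ∧ CAP+tail.
-/

set_option autoImplicit false

namespace Summit.QuantumFields.BalabanUV.T4Continuum.NE7b.BlockSquareRowMultiplicity

open Finset

variable {d N : ℕ} (n : ℕ)

/-! ## §0 The interior grid of a based square, characterised as an image (inhabited) -/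

/-- **THE INTERIOR GRID EXISTS**: `(c, i, j) ↦` the row bond `(x + ie_{a.1} + je_{a.2}, a.1)` (`c = true`) or the column bond
`(x + ie_{a.1} + je_{a.2}, a.2)` (`c = false`). [folklore] -/
theorem exists_grid :
    ∃ Gr : (Fin d → ZMod N) → {a : Fin d × Fin d // a.1 < a.2} → Finset ((Fin d → ZMod N) × Fin d),
      ∀ x a, Gr x a = univ.image (fun cij : Bool × Fin n × Fin n =>
        (x + Pi.single a.1.1 ((cij.2.1 : ℕ) : ZMod N) + Pi.single a.1.2 ((cij.2.2 : ℕ) : ZMod N),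
          if cij.1 then a.1.1 else a.1.2)) :=
  ⟨fun x a => univ.image (fun cij : Bool × Fin n × Fin n =>
        (x + Pi.single a.1.1 ((cij.2.1 : ℕ) : ZMod N) + Pi.single a.1.2 ((cij.2.2 : ℕ) : ZMod N),
          if cij.1 then a.1.1 else a.1.2)), fun _ _ => rfl⟩

section Counts

variable (Gr : (Fin d → ZMod N) → {a : Fin d × Fin d // a.1 < a.2} → Finset ((Fin d → ZMod N) × Fin d))
  (hGr : ∀ x a, Gr x a = univ.image (fun cij : Bool × Fin n × Fin n =>
        (x + Pi.single a.1.1 ((cij.2.1 : ℕ) : ZMod N) + Pi.single a.1.2 ((cij.2.2 : ℕ) : ZMod N),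
          if cij.1 then a.1.1 else a.1.2)))

/-! ## §1 Size: `#Gr ≤ 2n²` -/

include hGr in
/-- **THE INTERIOR GRID HAS AT MOST `2n²` BONDS.** [folklore] -/
theorem card_grid_le (x : Fin d → ZMod N) (a : {a : Fin d × Fin d // a.1 < a.2}) : (Gr x a).card ≤ 2 * n ^ 2 := by
  classical
  rw [hGr]
  refine card_image_le.trans ?_
  rw [card_univ, Fintype.card_prod, Fintype.card_prod, Fintype.card_bool, Fintype.card_fin, sq]

include hGr in
/-- The `v`-type normalisation letter: `#Gr·n⁻² ≤ 2` for `0 < n`. [folklore] -/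
theorem card_grid_mul_inv_sq_le_two (hn : 0 < n) (x : Fin d → ZMod N) (a : {a : Fin d × Fin d // a.1 < a.2}) :
    ((Gr x a).card : ℝ) * (1 / (n : ℝ) ^ 2) ≤ 2 := by
  have hn0 : (0 : ℝ) < (n : ℝ) := by exact_mod_cast hn
  have hn' : (0 : ℝ) < (n : ℝ) ^ 2 := pow_pos hn0 2
  rw [mul_one_div, div_le_iff₀ hn']
  exact_mod_cast card_grid_le n Gr hGr x a

/-! ## §2 Multiplicity: a fine bond lies in the interior grid of at most `(d−1)·n²` based squares -/

include hGr in
/-- **GRID MULTIPLICITY `≤ (d−1)·n²`**: a fine bond `(z, μ)` lies in the interior grid of the based square `(x, (α < β))` only if `μ ∈ {α, β}` and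
`x = z − ie_μ − je_ν` (`ν` the plane partner) for some `i, j < n` — cover by `{ν // ν ≠ μ} × Fin n × Fin n`.  Any `N`. [folklore] -/
theorem grid_multiplicity_le [NeZero N] (b : (Fin d → ZMod N) × Fin d) :
    (univ.filter fun xa : (Fin d → ZMod N) × {a : Fin d × Fin d // a.1 < a.2} => b ∈ Gr xa.1 xa.2).card ≤ (d - 1) * n ^ 2 := by
  classical
  obtain ⟨z, μ⟩ := b
  -- cover: (partner `ν ≠ μ`, offset along `μ`, offset along `ν`) ↦ (base point, plane {μ, ν})
  let ψ : {ν : Fin d // ν ≠ μ} × Fin n × Fin n → (Fin d → ZMod N) × {a : Fin d × Fin d // a.1 < a.2} := fun q =>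
    (z - Pi.single μ ((q.2.1 : ℕ) : ZMod N) - Pi.single q.1.1 ((q.2.2 : ℕ) : ZMod N),
     ⟨(min μ q.1.1, max μ q.1.1), min_lt_max.2 q.1.2.symm⟩)
  have hcover : (univ.filter fun xa : (Fin d → ZMod N) × {a : Fin d × Fin d // a.1 < a.2} => (z, μ) ∈ Gr xa.1 xa.2)
      ⊆ univ.image ψ := by
    rintro ⟨x, ⟨⟨α, β⟩, hαβ⟩⟩ hxa
    simp only [Finset.mem_filter, Finset.mem_univ, true_and, Finset.mem_image] at hxa ⊢
    rw [hGr] at hxa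
    obtain ⟨⟨c, i, j⟩, -, hcij⟩ := Finset.mem_image.1 hxa
    have hαβ' : α < β := hαβ
    cases c <;> simp only [if_true, Bool.false_eq_true, if_false, Prod.mk.injEq] at hcij <;> obtain ⟨hx, rfl⟩ := hcij
    · -- direction `β` (a column): `z = x + ie_α + je_β`, partner `α`, offsets `(j, i)`
      refine ⟨(⟨α, ne_of_lt hαβ'⟩, j, i), ?_⟩
      simp only [ψ, Prod.mk.injEq, min_eq_right hαβ'.le, max_eq_left hαβ'.le, and_true]
      rw [← hx]; abel
    · -- direction `α` (a row): `z = x + ie_α + je_β`, partner `β`, offsets `(i, j)`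
      refine ⟨(⟨β, ne_of_gt hαβ'⟩, i, j), ?_⟩
      simp only [ψ, Prod.mk.injEq, min_eq_left hαβ'.le, max_eq_right hαβ'.le, and_true]
      rw [← hx]; abel
  have hdom : Fintype.card ({ν : Fin d // ν ≠ μ} × Fin n × Fin n) = (d - 1) * n ^ 2 := by
    rw [Fintype.card_prod, Fintype.card_prod, Fintype.card_fin, Fintype.card_subtype, Finset.filter_ne',
      Finset.card_erase_of_mem (Finset.mem_univ μ), Finset.card_univ, Fintype.card_fin]
    ring
  calc _ ≤ (univ.image ψ).card := Finset.card_le_card hcover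
    _ ≤ Fintype.card ({ν : Fin d // ν ≠ μ} × Fin n × Fin n) := card_image_le.trans (by rw [Finset.card_univ])
    _ = (d - 1) * n ^ 2 := hdom

include hGr in
/-- **AT `d = 4`: every fine bond lies in the interior grid of at most `3n²` based squares.** [folklore] -/
theorem grid_multiplicity_le_four [NeZero N] (hd : d = 4) (b : (Fin d → ZMod N) × Fin d) :
    (univ.filter fun xa : (Fin d → ZMod N) × {a : Fin d × Fin d // a.1 < a.2} => b ∈ Gr xa.1 xa.2).card ≤ 3 * n ^ 2 := by
  have h := grid_multiplicity_le n Gr hGr b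
  subst hd
  simpa using h

end Counts

end Summit.QuantumFields.BalabanUV.T4Continuum.NE7b.BlockSquareRowMultiplicity
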